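import Literature.NumberTheory.EllipticCurves.Wuthrich2014.ThreeAdicImageSupersingularProofs
import Literature.NumberTheory.GaloisRepresentations.TateLevelOneWildOdd
import Literature.NumberTheory.DiophantineGeometry.GenEllLAdicImageSurjective
import Literature.NumberTheory.Automorphic.QuadraticCharacterTwist
import Literature.NumberTheory.EllipticCurves.Rank1Residual.Predicates
import Literature.NumberTheory.EllipticCurves.HeegnerPoints
import Literature.NumberTheory.EllipticCurves.PAdicGrossZagierConstantTermProofs
import Literature.NumberTheory.EllipticCurves.NonEisensteinPrimeOfSurjective
import Summits.BirchSwinnertonDyer.BirchSwinnertonDyer.Theorems.UniversalToricDescentTorsionImageIndexTwo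
import HarnessLib

/-!
# The `3`-adic image over `K` for the UTD twins: `Gal(K̄/K) → Aut(E[3ⁿ])` onto for every `n`
# (Howard 2004 Thm. B's image hypothesis at `p = 3`), for `E/ℚ` not additive at `3` with `ρ̄_{E,3}`
# onto and every quadratic `K` with `3 ∤ d_K`

Route `UniversalToricDescent` (BirchSwinnertonDyer), `--supports` crux stmt-BirchSwinnertonDyer-23594
`TwinSplitIMCAtThreeGoodSSApZero` (and 20695 / 20694). Namespace
`Summit.BirchSwinnertonDyer.BirchSwinnertonDyer.Theorems.ThreeAdicImageOverK`. THEOREMS ONLY (no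
definition, no named fact). Seat bsd-wall-utd-p2 (LEAD, «⊇-half only»), line `threeframes(-apzero)`,
stub `stub_howardFrameSS_apZero`.

WHY. The `⊇`-half of crux #3 at a good-supersingular twin (`L′ ∈ Ch_Λ(X_{∅,0})·R₀⟦T⟧`, the Howard /
Kolyvagin-system direction) is a PORT to `p = 3` of Castella–Wan, Math. Ann. 389 (2024) §5–§6.1
resting on Howard's Heegner-point Kolyvagin system (Howard, Compos. Math. 140 (2004), Thm. B), whose
image hypothesis is «`Gal(K̄/K) → Aut_{ℤ_p}(T_pE)` is surjective» — over the imaginary quadratic `K`,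
`p`-ADICALLY. The crux carries only «`ρ̄_{E′,3} : Γ_ℚ → GL₂(𝔽₃)` onto». At `p ≥ 5` the two are
bridged by Serre (IV-23) and `K ∩ ℚ(E[p]) = ℚ`; at `p = 3` mod-`3` onto does NOT imply `3`-adic onto
over `ℚ` in general (Elkies 2006), and `ℚ(E[3]) ⊇ ℚ(√-3)`. The seat's mechanism audit
(SUPSET-AT3-v8 §1(d)) isolated this as the one MATHEMATICAL `p = 3` delta of the port besides carrier
typing. Over `ℚ` it is a TREE THEOREM for every curve not additive at `3` — Wuthrich, Doc. Math. 19
(2014), Lemma 20, proved in `Wuthrich2014/ThreeAdicImage{Ordinary,Supersingular}Proofs`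
(`WeierstrassCurve.forall_hasSurjectiveModNGaloisRep_three_pow_of_not_additive_of_surj`; the
good-supersingular case by the wild ramification of the `9`-torsion of the height-`2` formal group,
`exists_mem_inertia_fixing_three_not_scalar_nine`). THIS FILE does the passage `ℚ → K`:

* `hasSurjectiveModNGaloisRep_three_baseChange` — `E/ℚ`, `ρ̄_{E,3}` onto, `K` quadratic with
  `3 ∤ d_K` ⟹ `ρ̄_{E_K,3} : Γ_K → Aut(E_K[3])` onto (`Gal(ℚ̄/K) ≤ Γ_ℚ` has index `2`, so contains
  all squares, and contains a lift of `σ ∈ Γ_K` with `χ₃(σ) = -1` — `χ₃|_{Γ_K}` is onto because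
  `3 ∤ d_K`, tree `modNCyclotomicCharacter_surjective_of_forall_prime_dvd_not_dvd_discr`; then
  `forall_exists_mem_smul_eq_three` and the transport `hasSurjectiveModNGaloisRep_baseChange_of_forall_exists`).
* `hasSurjectiveModNGaloisRep_three_pow_baseChange` — if moreover `ρ̄_{E,3ⁿ}` is onto over `ℚ` for
  all `n`, then `Γ_K → Aut(E_K[3ⁿ])` is onto for all `n` (odd-power tower lemma
  `forall_exists_mem_smul_eq_pow`: `[Γ_ℚ : Γ_K] = 2` is prime to `3`).
* `forall_hasSurjectiveModNGaloisRep_three_pow_baseChange_of_not_additive` — **for `E/ℚ` minimal,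
  good or multiplicative at `3`, `ρ̄_{E,3}` onto, `K` quadratic with `3 ∤ d_K`: `Γ_K → Aut(E_K[3ⁿ])`
  onto for every `n`** (`ℚ`-tower by Wuthrich's Lemma 20).
* Crux vocabulary (§6): `forall_hasSurjectiveModNGaloisRep_three_pow_of_goodSS` (over `ℚ`,
  `GoodSS W′ 3` = good at `3` and `3 ∣ a₃`, i.e. `a₃ ∈ {0, ±3}` — BOTH halves of 20695),
  `forall_hasSurjectiveModNGaloisRep_three_pow_baseChange_of_goodSS` and `…_of_not_addv` (over `K`
  imaginary quadratic with two distinct primes `𝔭 ≠ 𝔭′` above `3`, the crux's binders; `3 ∤ d_K`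
  by `not_three_dvd_discr_of_ne`).

CONSEQUENCE FOR THE LINE (numbers, not adjectives): input (d) «`3`-adic image over `K`» of the
`⊇`-port of `stub_howardFrameSS_apZero` (and of `stub_howardFrameMult`, and of bucket A's referee
flag on BCS25 Thm. 4.2.1(b) at `p = 3`) is DISCHARGED as a tree theorem for all `2 023` twin classes
(A `745` · B `675` · C `603`): no class-number, no `j`-invariant and no `3`-adic census condition
remains. The stub itself stays OPEN (± anticyclotomic carriers at `a₃ = 0` untyped; port unperformed).
BSD is not proved by any of this.

## References
* [Wuthrich2014] C. Wuthrich, Doc. Math. 19 (2014) 381–402, Lemma 20 (p. 399).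
* [Howard2004] B. Howard, *The Heegner point Kolyvagin system*, Compos. Math. 140 (2004), Thm. B
  and §0 (hypothesis «`Gal(K̄/K) → Aut_{ℤ_p}(T)` surjective», `(p, D, N)` pairwise coprime).
* [CastellaWan2023] F. Castella, X. Wan, Math. Ann. 389 (2024), §5.4 Thm. 5.12 (same hypothesis).
* [Serre1972] J.-P. Serre, Invent. Math. 15 (1972), §4.2, §5.3. [Elkies2006ThreeAdic] N. D. Elkies,
  arXiv:math/0612734 (mod-`3` onto, not mod-`9`).
-/

noncomputable section

open scoped Classical

set_option linter.dupNamespace false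
set_option autoImplicit false

namespace Summit.BirchSwinnertonDyer.BirchSwinnertonDyer.Theorems.ThreeAdicImageOverK

open WeierstrassCurve Field Literature.NumberTheory.EllipticCurves
  Literature.NumberTheory.GaloisRepresentations

universe u

/-! ### §5 Over `ℚ`: quadratic fields `K` with `3 ∤ d_K` -/

section OverQ

variable (W : WeierstrassCurve ℚ) [W.IsElliptic] (K : Type) [Field K] [NumberField K]

/-- For a quadratic field `K` with `3 ∤ d_K`, the subgroup `Gal(ℚ̄/K) ≤ Γ_ℚ` (the range of the
restriction `Γ_K → Γ_ℚ`) contains every square and an element `h₀` with `χ₃(h₀) ≠ 1` (a lift of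
any `σ ∈ Γ_K` with `χ₃(σ) = -1`, which exists because `K ∩ ℚ(ζ₃) = ℚ`:
`modNCyclotomicCharacter_surjective_of_forall_prime_dvd_not_dvd_discr`). [folklore] -/
theorem sq_mem_range_and_exists_modNCyclotomicCharacter_ne_one (h2 : Module.finrank ℚ K = 2)
    (hd : ¬ (3 : ℤ) ∣ NumberField.discr K) :
    (∀ g : absoluteGaloisGroup ℚ, g * g ∈ (absGaloisRestrict ℚ K).range) ∧
      ∃ h ∈ (absGaloisRestrict ℚ K).range, modNCyclotomicCharacter ℚ 3 h ≠ 1 := by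
  obtain ⟨-, hind⟩ := Literature.NumberTheory.Automorphic.isOpen_range_absGaloisRestrict_and_index_eq_two ℚ K h2
  refine ⟨fun g ↦ Subgroup.mul_self_mem_of_index_two hind g, ?_⟩
  haveI : NeZero ((3 : ℕ) : K) := ⟨Nat.cast_ne_zero.mpr (by norm_num)⟩
  have hcop : ∀ p : ℕ, p.Prime → p ∣ 3 → ¬ ((p : ℤ) ∣ NumberField.discr K) := by
    intro p hp hp3
    rw [(Nat.prime_dvd_prime_iff_eq hp Nat.prime_three).mp hp3]
    exact_mod_cast hd
  obtain ⟨σ, hσ⟩ := modNCyclotomicCharacter_surjective_of_forall_prime_dvd_not_dvd_discr K 3 hcop (-1)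
  refine ⟨absGaloisRestrict ℚ K σ, ⟨σ, rfl⟩, ?_⟩
  rw [modNCyclotomicCharacter_absGaloisRestrict ℚ K 3 σ, hσ]
  decide

/-- **`Gal(ℚ̄/K)` still acts on `E[3]` through all of `Aut(E[3])`** for `E/ℚ` with `ρ̄_{E,3}` onto and
`K` quadratic with `3 ∤ d_K`: `(E_K).HasSurjectiveModNGaloisRep 3`. (At `p = 3` the only quadratic
subfield of `ℚ(E[3])` is `ℚ(√-3)`, cut out by `det = χ₃`.) [folklore] -/
theorem hasSurjectiveModNGaloisRep_three_baseChange (h2 : Module.finrank ℚ K = 2)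
    (hd : ¬ (3 : ℤ) ∣ NumberField.discr K) (hsurj : W.HasSurjectiveModNGaloisRep 3) :
    (W.baseChange K).HasSurjectiveModNGaloisRep 3 := by
  haveI : NeZero ((3 : ℕ) : ℚ) := ⟨by norm_num⟩
  obtain ⟨hsq, h₀⟩ := sq_mem_range_and_exists_modNCyclotomicCharacter_ne_one K h2 hd
  have h3 := forall_exists_mem_smul_eq_three W hsurj _ hsq h₀
  refine hasSurjectiveModNGaloisRep_baseChange_of_forall_exists W K 3 hsurj fun γ ↦ ?_
  obtain ⟨h, ⟨δ, rfl⟩, hh⟩ := h3 γ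
  exact ⟨δ, hh⟩

/-- In particular `E[3]` stays IRREDUCIBLE over `K` (the standing hypothesis «`E[p]|_{G_K}`
irreducible» of Castella–Wan 2024 §5, Lemma 5.3 / Thm. 2.3, at `p = 3`), from surjectivity over `K`
(`hasIrreducibleModPGaloisRep_of_hasSurjectiveModNGaloisRep`). [cite: CastellaWan2023, §5.1 and Lemma 5.3 (hypotheses)] -/
theorem hasIrreducibleModPGaloisRep_three_baseChange (h2 : Module.finrank ℚ K = 2)
    (hd : ¬ (3 : ℤ) ∣ NumberField.discr K) (hsurj : W.HasSurjectiveModNGaloisRep 3) :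
    (W.baseChange K).HasIrreducibleModPGaloisRep 3 := by
  haveI : Fact (Nat.Prime 3) := ⟨Nat.prime_three⟩
  haveI : NeZero ((3 : ℕ) : K) := ⟨Nat.cast_ne_zero.mpr (by norm_num)⟩
  exact hasIrreducibleModPGaloisRep_of_hasSurjectiveModNGaloisRep (W.baseChange K) 3
    (hasSurjectiveModNGaloisRep_three_baseChange W K h2 hd hsurj)

/-- **The `3`-adic tower over `K`**: if `ρ̄_{E,3ⁿ} : Γ_ℚ → Aut(E[3ⁿ])` is onto for every `n`, then so is
`Γ_K → Aut(E_K[3ⁿ])` for every quadratic `K` with `3 ∤ d_K` — i.e. `Gal(K̄/K) → GL₂(ℤ₃)` is onto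
(level `3` by `hasSurjectiveModNGaloisRep_three_baseChange`; the levels `3ⁿ` by the odd-power tower
lemma `forall_exists_mem_smul_eq_pow`, `[Γ_ℚ : Γ_K] = 2` being prime to `3`). [folklore] -/
theorem hasSurjectiveModNGaloisRep_three_pow_baseChange (h2 : Module.finrank ℚ K = 2)
    (hd : ¬ (3 : ℤ) ∣ NumberField.discr K)
    (hsurj : ∀ n : ℕ, W.HasSurjectiveModNGaloisRep ((3 ^ n : ℕ) : ℤ)) (n : ℕ) :
    (W.baseChange K).HasSurjectiveModNGaloisRep ((3 ^ n : ℕ) : ℤ) := by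
  haveI : NeZero ((3 : ℕ) : ℚ) := ⟨by norm_num⟩
  obtain ⟨hsq, h₀⟩ := sq_mem_range_and_exists_modNCyclotomicCharacter_ne_one K h2 hd
  have h1 : W.HasSurjectiveModNGaloisRep 3 := by simpa using hsurj 1
  have h3 := forall_exists_mem_smul_eq_three W h1 _ hsq h₀
  have h3n := forall_exists_mem_smul_eq_pow W 3 (by decide) _ hsq h3 n
  refine hasSurjectiveModNGaloisRep_baseChange_of_forall_exists W K (3 ^ n) (hsurj n) fun γ ↦ ?_
  obtain ⟨h, ⟨δ, rfl⟩, hh⟩ := h3n γ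
  exact ⟨δ, hh⟩

/-- **Wuthrich 2014 Lemma 20 over `K`.** For `E/ℚ` (globally minimal model) with good or multiplicative
reduction at `3` (`9 ∤ N_E`) and `ρ̄_{E,3}` onto, and `K` quadratic with `3 ∤ d_K`:
`Γ_K → Aut(E_K[3ⁿ])` is onto for every `n` — the `3`-adic image of `Gal(K̄/K)` is `GL₂(ℤ₃)`
(the image hypothesis «`Gal(K̄/K) → Aut_{ℤ_p}(T)` surjective» of Howard's Heegner-point Kolyvagin
system, Howard 2004 Thm. B, at `p = 3`). The `ℚ`-tower is the tree theorem
`WeierstrassCurve.forall_hasSurjectiveModNGaloisRep_three_pow_of_not_additive_of_surj`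
(`Wuthrich2014/ThreeAdicImage{Ordinary,Supersingular}Proofs`). [cite: Wuthrich2014, Lemma 20 (p. 399)]
[cite: Howard2004, Thm. B (hypotheses)] -/
theorem forall_hasSurjectiveModNGaloisRep_three_pow_baseChange_of_not_additive [W.IsGloballyMinimal]
    (h2 : Module.finrank ℚ K = 2) (hd : ¬ (3 : ℤ) ∣ NumberField.discr K)
    (hred : W.HasGoodReductionAtPrime 3 ∨ W.HasMultiplicativeReductionAtPrime 3)
    (hsurj : W.HasSurjectiveModNGaloisRep 3) (n : ℕ) :
    (W.baseChange K).HasSurjectiveModNGaloisRep ((3 ^ n : ℕ) : ℤ) :=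
  hasSurjectiveModNGaloisRep_three_pow_baseChange W K h2 hd
    (W.forall_hasSurjectiveModNGaloisRep_three_pow_of_not_additive_of_surj hred hsurj) n

end OverQ

/-! ### §6 The UTD twins: crux vocabulary (`GoodSS W' 3` / `¬ Addv W' 3`, `IsImaginaryQuadratic K`, `3 = 𝔭𝔭'` split) -/

section Twins

open NumberField IsDedekindDomain Literature.NumberTheory.EllipticCurves.Rank1Residual

variable {K : Type} [Field K] [NumberField K]

omit [NumberField K] in
/-- A place of `K` containing the rational prime `p` lies over `(p)`. [folklore] -/
private theorem asIdeal_mem_primesOver_of_natCast_mem {p : ℕ} (hp : p.Prime)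
    {w : HeightOneSpectrum (𝓞 K)} (hw : ((p : ℕ) : 𝓞 K) ∈ w.asIdeal) :
    w.asIdeal ∈ (Ideal.span {(p : ℤ)}).primesOver (𝓞 K) := by
  refine ⟨w.isPrime, ⟨?_⟩⟩
  have hmax : (Ideal.span {(p : ℤ)}).IsMaximal :=
    ((Ideal.span_singleton_prime (Int.natCast_ne_zero.mpr hp.ne_zero)).mpr
      (Nat.prime_iff_prime_int.mp hp)).isMaximal
      (by simpa using Int.natCast_ne_zero.mpr hp.ne_zero)
  refine hmax.eq_of_le (Ideal.IsPrime.ne_top inferInstance) ?_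
  rw [Ideal.span_le, Set.singleton_subset_iff, SetLike.mem_coe, Ideal.under_def, Ideal.mem_comap,
    eq_intCast]
  exact_mod_cast hw

/-- **Two distinct primes above `p` in a quadratic field: `p` splits, `#{𝔓 ∣ p} = 2`** (fundamental
identity `#{𝔓 ∣ p}·e·f = 2` for the Galois extension `K/ℚ`). [folklore] -/
theorem ncard_primesOver_eq_two_of_ne (h2 : Module.finrank ℚ K = 2) {p : ℕ} (hp : p.Prime)
    {𝔭 𝔭' : HeightOneSpectrum (𝓞 K)} (h𝔭 : ((p : ℕ) : 𝓞 K) ∈ 𝔭.asIdeal)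
    (h𝔭' : ((p : ℕ) : 𝓞 K) ∈ 𝔭'.asIdeal) (hne : 𝔭' ≠ 𝔭) :
    ((Ideal.span {(p : ℤ)}).primesOver (𝓞 K)).ncard = 2 := by
  haveI : Algebra.IsQuadraticExtension ℚ K := ⟨h2⟩
  haveI : (Ideal.span {(p : ℤ)}).IsPrime :=
    (Ideal.span_singleton_prime (by exact_mod_cast hp.ne_zero)).mpr (Nat.prime_iff_prime_int.mp hp)
  set G := K ≃ₐ[ℚ] K
  have hG : Nat.card G = 2 := by rw [IsGalois.card_aut_eq_finrank, h2]
  have hid := Ideal.ncard_primesOver_mul_ramificationIdxIn_mul_inertiaDegIn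
    (Ideal.span {(p : ℤ)}) (𝓞 K) G
  rw [hG] at hid
  set T := (Ideal.span {(p : ℤ)}).primesOver (𝓞 K) with hT
  have hfin : T.Finite := by
    refine Set.finite_of_ncard_ne_zero fun h0 ↦ ?_
    rw [h0] at hid
    omega
  have hne' : 𝔭.asIdeal ≠ 𝔭'.asIdeal := fun e ↦ hne (HeightOneSpectrum.ext e.symm)
  have hsub : ({𝔭.asIdeal, 𝔭'.asIdeal} : Set (Ideal (𝓞 K))) ⊆ T := by
    intro x hx
    rcases hx with rfl | rfl
    · exact asIdeal_mem_primesOver_of_natCast_mem hp h𝔭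
    · exact asIdeal_mem_primesOver_of_natCast_mem hp h𝔭'
  have h2le : 2 ≤ T.ncard := by
    have := Set.ncard_le_ncard hsub hfin
    rwa [Set.ncard_pair hne'] at this
  have he : (Ideal.span {(p : ℤ)}).ramificationIdxIn (𝓞 K) ≠ 0 := Ideal.ramificationIdxIn_ne_zero G
  have hf : (Ideal.span {(p : ℤ)}).inertiaDegIn (𝓞 K) ≠ 0 := Ideal.inertiaDegIn_ne_zero G
  have hef : 1 ≤ (Ideal.span {(p : ℤ)}).ramificationIdxIn (𝓞 K) *
      (Ideal.span {(p : ℤ)}).inertiaDegIn (𝓞 K) := Nat.one_le_iff_ne_zero.mpr (mul_ne_zero he hf)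
  nlinarith

/-- For `K` quadratic with `3 = 𝔭𝔭'` split (`𝔭 ≠ 𝔭'` above `3`): `3 ∤ d_K`. [folklore] -/
theorem not_three_dvd_discr_of_ne (h2 : Module.finrank ℚ K = 2)
    {𝔭 𝔭' : HeightOneSpectrum (𝓞 K)} (h𝔭 : ((3 : ℕ) : 𝓞 K) ∈ 𝔭.asIdeal)
    (h𝔭' : ((3 : ℕ) : 𝓞 K) ∈ 𝔭'.asIdeal) (hne : 𝔭' ≠ 𝔭) : ¬ (3 : ℤ) ∣ NumberField.discr K := by
  have h := ncard_primesOver_eq_two_of_ne h2 Nat.prime_three h𝔭 h𝔭' hne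
  exact_mod_cast not_dvd_discr_of_ncard_primesOver (K := K) Nat.prime_three (h.trans h2.symm)

/-- **The `3`-adic image input of the `⊇`-port, over `ℚ`, in crux vocabulary**: a good-supersingular
twin (`GoodSS W' 3`: good reduction at `3` and `3 ∣ a₃`, so `a₃ ∈ {0, ±3}`) with `ρ̄_{W′,3}` onto has
`ρ̄_{W′,3ⁿ}` onto for every `n` — Wuthrich 2014 Lemma 20, good supersingular case, tree theorem
`WeierstrassCurve.forall_hasSurjectiveModNGaloisRep_three_pow_of_goodSupersingular_of_surj`.
[cite: Wuthrich2014, Lemma 20 (p. 399)] -/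
theorem forall_hasSurjectiveModNGaloisRep_three_pow_of_goodSS (W' : WeierstrassCurve ℚ)
    [W'.IsElliptic] [W'.IsGloballyMinimal] (hss : GoodSS W' 3)
    (hsurj : W'.HasSurjectiveModNGaloisRep 3) (n : ℕ) :
    W'.HasSurjectiveModNGaloisRep ((3 ^ n : ℕ) : ℤ) :=
  W'.forall_hasSurjectiveModNGaloisRep_three_pow_of_goodSupersingular_of_surj hss.1 hss.2 hsurj n

/-- **The `3`-adic image input of the `⊇`-port, over `K`, in crux vocabulary** (crux
`TwinSplitIMCAtThreeGoodSSApZero`, stmt-BirchSwinnertonDyer-23594, and its parent 20695: the binders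
`GoodSS W' 3`, `W'.HasSurjectiveModNGaloisRep 3`, `IsImaginaryQuadratic K`, `3 ∈ 𝔭`, `3 ∈ 𝔭'`,
`𝔭' ≠ 𝔭`): for every `n`, `Γ_K → Aut(E′_K[3ⁿ])` is onto, i.e. **`Gal(K̄/K) → Aut_{ℤ₃}(T₃E′)` is
surjective** — hypothesis of Howard 2004 Thm. B / Castella–Wan 2024 Thm. 5.12 at `p = 3`, which at
`p ≥ 5` follows from `ρ̄` onto by Serre and at `p = 3` does not in general (Elkies).
[cite: Howard2004, Thm. B (hypotheses)] [cite: Wuthrich2014, Lemma 20 (p. 399)] -/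
theorem forall_hasSurjectiveModNGaloisRep_three_pow_baseChange_of_goodSS (W' : WeierstrassCurve ℚ)
    [W'.IsElliptic] [W'.IsGloballyMinimal] (K : Type) [Field K] [NumberField K]
    (hss : GoodSS W' 3) (hsurj : W'.HasSurjectiveModNGaloisRep 3) (hK : IsImaginaryQuadratic K)
    {𝔭 𝔭' : HeightOneSpectrum (𝓞 K)} (h𝔭 : ((3 : ℕ) : 𝓞 K) ∈ 𝔭.asIdeal)
    (h𝔭' : ((3 : ℕ) : 𝓞 K) ∈ 𝔭'.asIdeal) (hne : 𝔭' ≠ 𝔭) (n : ℕ) :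
    (W'.baseChange K).HasSurjectiveModNGaloisRep ((3 ^ n : ℕ) : ℤ) :=
  forall_hasSurjectiveModNGaloisRep_three_pow_baseChange_of_not_additive W' K hK.1
    (not_three_dvd_discr_of_ne hK.1 h𝔭 h𝔭' hne) (Or.inl hss.1) hsurj n

/-- The same for EVERY twin of the UTD cell (`¬ Addv W' 3`: good or multiplicative at `3` — the
binder of the parent crux `TwinSplitIMCAtThree` and of the bucket-B crux `TwinSplitIMCAtThreeMult`,
stmt-BirchSwinnertonDyer-20694). [cite: Wuthrich2014, Lemma 20 (p. 399)] [cite: Howard2004, Thm. B (hypotheses)] -/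
theorem forall_hasSurjectiveModNGaloisRep_three_pow_baseChange_of_not_addv (W' : WeierstrassCurve ℚ)
    [W'.IsElliptic] [W'.IsGloballyMinimal] (K : Type) [Field K] [NumberField K]
    (hred : ¬ Addv W' 3) (hsurj : W'.HasSurjectiveModNGaloisRep 3) (hK : IsImaginaryQuadratic K)
    {𝔭 𝔭' : HeightOneSpectrum (𝓞 K)} (h𝔭 : ((3 : ℕ) : 𝓞 K) ∈ 𝔭.asIdeal)
    (h𝔭' : ((3 : ℕ) : 𝓞 K) ∈ 𝔭'.asIdeal) (hne : 𝔭' ≠ 𝔭) (n : ℕ) :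
    (W'.baseChange K).HasSurjectiveModNGaloisRep ((3 ^ n : ℕ) : ℤ) := by
  have hred' : W'.HasGoodReductionAtPrime 3 ∨ W'.HasMultiplicativeReductionAtPrime 3 := by
    by_contra h
    exact hred ⟨fun hg ↦ h (Or.inl hg), fun hm ↦ h (Or.inr hm)⟩
  exact forall_hasSurjectiveModNGaloisRep_three_pow_baseChange_of_not_additive W' K hK.1
    (not_three_dvd_discr_of_ne hK.1 h𝔭 h𝔭' hne) hred' hsurj n

end Twins

end Summit.BirchSwinnertonDyer.BirchSwinnertonDyer.Theorems.ThreeAdicImageOverK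

end
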